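import Summits.HodgeConjecture.HodgeConjecture.Theorems.K2E1ChiLocalWeightShellU2      -- ★ p862239 (this seat) FILE 2: `chi_eq_pow_of_valued_eq`, `norm_prod_chi_le_one`; brings ★ `chi_eq_of_valued_eq_one`, the `P_v`∕`ι_w` tokens
import HarnessLib

/-!
# K2·E1 ∕ R90·S8 — `K2E1ChiLocalWeightContinuousU2` (J2′-2-NONSPLIT, FILE 4): the Iwasawa weight of an unramified `χ` is CONTINUOUS (locally constant) and has modulus `≤ 1` —
# the side letters `(hωc) Continuous (ω v)`, `(hωb) ‖ω v t‖ ≤ 1` of J2′-1 (`K2E1ChiIntertwiningScalarEulerProductU2`, K2E1-p13 (g4))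

Cell `pub/hodgecm-mathlib`, crux h413 = `stmt-HodgeConjecture-24833`, route of record `HCCMUnconditional`; R90-TF section S8 «ContSpec-n½», deal S8-R19 ∕ S8-R22 (R90-CS-plan (g2))
«J2′-2-NONSPLIT» to R90-C10-p07 (g0), FILE 4 (FILE 1 ★ p862220, FILE 2 ★ p862239, FILE 3 📤).  THEOREMS ONLY (no `def`, no `instance`, no notation, no named-fact hypothesis, no `sorry`;
default heartbeats); lane `--supports stmt-HodgeConjecture-24833 --as helper` (count-neutral; closes no socket).  Dealer's ruling S8-R22 (1): «type `ω_v` CONTINUOUS».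

THE MATHEMATICS.  The weight is `ω_v(t) = 1` for `t ∈ 𝒪_v` and `ω_v(t) = ∏_{w∣v} χ_w(a_w(t))` for `t ∉ 𝒪_v`, where the unit `a_w(t)` of `L_w` is `−(ι_w t·δ_w)⁻¹` (hypothesis-first, as in FILE 2).
It is LOCALLY CONSTANT: around `t₀ ∈ 𝒪_v` the ball `{v(t − t₀) < 1}` lies in `𝒪_v` (ultrametric inequality); around `t₀ ∉ 𝒪_v` the ball `{v(t − t₀) < v(t₀)}` has `v(t) = v(t₀)`
(★ Mathlib `Valuation.map_eq_of_sub_lt`), hence `v_w(a_w(t)) = v_w(a_w(t₀))` (`v_w ∘ ι_w = v_v^{e}`, ★ `Extension.valued_adicCompletionSemialgHom`) and `χ_w(a_w(t)) = χ_w(a_w(t₀))` for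
UNRAMIFIED `χ_w` (★ `K2LiuGKRankOneValue.chi_eq_of_valued_eq_one`).  A locally constant function is continuous (Mathlib `IsLocallyConstant.continuous`).  Modulus: `‖ω_v‖ ≤ 1` when
`‖χ_w‖ ≤ 1` (★ FILE 2 `norm_prod_chi_le_one`).
* §1 **`continuous_weight`** — `Continuous ω_v`;  §2 **`norm_weight_le_one`** — `‖ω_v(t)‖ ≤ 1`.
HONEST LABEL: HC_CM is proved only modulo the 7 printed citations (2 remaining named inputs: hLiu418 = `stmt-HodgeConjecture-24832`, h413 = `stmt-HodgeConjecture-24833`) until rung 0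
closes; REL ≠ ★ ≠ BUILT; this file asserts no named fact and closes no socket; count-neutral.

## References
* [Casselman1980] W. Casselman, *The unramified principal series of p-adic groups I*, Compositio Math. 40 (1980), §3 (unramified characters are locally constant on `F^×`).
* [BourbakiGT1] N. Bourbaki, *General Topology* I, Ch. I §3 (locally constant functions).
* [CasselsFrohlichANT1967] J. W. S. Cassels, A. Fröhlich (eds.), *Algebraic Number Theory* (1967), Ch. II §10.
-/

set_option autoImplicit false
set_option linter.dupNamespace false

noncomputable section

open NumberField IsDedekindDomain IsDedekindDomain.HeightOneSpectrum Set Filter Topology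
open scoped NNReal
open Literature.NumberTheory.GaloisRepresentations.IsNonarchimedeanLocalField Literature.NumberTheory.Automorphic
open Summit.HodgeConjecture.HodgeConjecture.Cruxes.HLiu418.K2LiuGKRankOneValue (chi_eq_of_valued_eq_one)

namespace Summit.HodgeConjecture.HodgeConjecture.Cruxes.H413.K2E1ChiLocalWeightContinuousU2

variable (L : Type) [Field L] [NumberField L] [IsCMField L] {δ : L} (v : HeightOneSpectrum (𝓞 ↥(maximalRealSubfield L)))

omit [IsCMField L] in
/-- **THE IWASAWA WEIGHT OF AN UNRAMIFIED `χ` IS CONTINUOUS** (indeed locally constant): `ω_v = 1` on `𝒪_v`, `ω_v(t) = ∏_{w∣v} χ_w(a_w(t))` off `𝒪_v` with units `a_w(t) = −(ι_w t·δ_w)⁻¹`,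
`χ_w` unramified for every `w ∣ v` — letter `(hωc)` of J2′-1. [cite: Casselman1980, §3] [cite: BourbakiGT1, Ch. I §3] -/
theorem continuous_weight
    (χ : ∀ w : v.Extension (𝓞 L), (w.1.adicCompletion L)ˣ →* ℂˣ)
    (hχ : ∀ (w : v.Extension (𝓞 L)) (u : (w.1.adicCompletion L)ˣ), Valued.v (u : w.1.adicCompletion L) = 1 → χ w u = 1)
    (a : ∀ w : v.Extension (𝓞 L), v.adicCompletion ↥(maximalRealSubfield L) → (w.1.adicCompletion L)ˣ)
    (ha : ∀ (w : v.Extension (𝓞 L)) (t : v.adicCompletion ↥(maximalRealSubfield L)), t ∉ v.adicCompletionIntegers ↥(maximalRealSubfield L) →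
      ((a w t : (w.1.adicCompletion L)ˣ) : w.1.adicCompletion L) =
        -(Extension.adicCompletionSemialgHom ↥(maximalRealSubfield L) L w t * (algebraMap L (FiniteAdeleRing (𝓞 L) L) δ) w.1)⁻¹)
    (ω : v.adicCompletion ↥(maximalRealSubfield L) → ℂ)
    (hω0 : ∀ t ∈ v.adicCompletionIntegers ↥(maximalRealSubfield L), ω t = 1)
    (hωout : ∀ t : v.adicCompletion ↥(maximalRealSubfield L), t ∉ v.adicCompletionIntegers ↥(maximalRealSubfield L) →
      ω t = (letI := Extension.fintype (𝓞 ↥(maximalRealSubfield L)) ↥(maximalRealSubfield L) L (𝓞 L) v; ∏ w : v.Extension (𝓞 L), ((χ w (a w t) : ℂˣ) : ℂ))) :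
    Continuous ω := by
  letI := Extension.fintype (𝓞 ↥(maximalRealSubfield L)) ↥(maximalRealSubfield L) L (𝓞 L) v
  refine ((IsLocallyConstant.iff_eventually_eq ω).2 fun t₀ => ?_).continuous
  by_cases h0 : t₀ ∈ v.adicCompletionIntegers ↥(maximalRealSubfield L)
  · -- `𝒪_v` is open (Mathlib `Valued.isOpen_valuationSubring`) and `ω = 1` there
    have hO : IsOpen ((v.adicCompletionIntegers ↥(maximalRealSubfield L) : Set (v.adicCompletion ↥(maximalRealSubfield L)))) :=
      Valued.isOpen_valuationSubring _
    filter_upwards [hO.mem_nhds h0] with t ht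
    rw [hω0 t ht, hω0 t₀ h0]
  · -- off `𝒪_v` the valuation is locally constant (Mathlib `Valued.locally_const`)
    have hv0 : Valued.v t₀ ≠ 0 := fun h => h0 (by rw [mem_adicCompletionIntegers, h]; exact zero_le)
    filter_upwards [Valued.locally_const hv0] with t hvt
    replace hvt : Valued.v t = Valued.v t₀ := hvt
    have ht0 : t ∉ v.adicCompletionIntegers ↥(maximalRealSubfield L) := fun h => h0 (by rw [mem_adicCompletionIntegers] at h ⊢; rwa [← hvt])
    rw [hωout t ht0, hωout t₀ h0]
    refine Finset.prod_congr rfl fun w _ => ?_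
    congr 1
    refine chi_eq_of_valued_eq_one L (χ w) (hχ w) (a w t) (a w t₀) ?_
    have hX : Valued.v ((a w t : (w.1.adicCompletion L)ˣ) : w.1.adicCompletion L) = Valued.v ((a w t₀ : (w.1.adicCompletion L)ˣ) : w.1.adicCompletion L) := by
      rw [ha w t ht0, ha w t₀ h0, Valuation.map_neg, Valuation.map_neg, map_inv₀, map_inv₀, map_mul, map_mul,
        Extension.valued_adicCompletionSemialgHom, Extension.valued_adicCompletionSemialgHom, hvt]
    have hne : Valued.v ((a w t₀ : (w.1.adicCompletion L)ˣ) : w.1.adicCompletion L) ≠ 0 := (Valuation.ne_zero_iff _).2 (a w t₀).ne_zero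
    rw [Units.val_mul, Units.val_inv_eq_inv_val, map_mul, map_inv₀, hX, mul_inv_cancel₀ hne]

omit [IsCMField L] in
/-- **`‖ω_v(t)‖ ≤ 1`** for the Iwasawa weight when `‖χ_w‖ ≤ 1` (e.g. unitary) — letter `(hωb)` of J2′-1 (`= 1` on `𝒪_v`; ★ FILE 2 `norm_prod_chi_le_one` off `𝒪_v`). [folklore] -/
theorem norm_weight_le_one
    (χ : ∀ w : v.Extension (𝓞 L), (w.1.adicCompletion L)ˣ →* ℂˣ) (hχb : ∀ (w : v.Extension (𝓞 L)) (u : (w.1.adicCompletion L)ˣ), ‖((χ w u : ℂˣ) : ℂ)‖ ≤ 1)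
    (a : ∀ w : v.Extension (𝓞 L), v.adicCompletion ↥(maximalRealSubfield L) → (w.1.adicCompletion L)ˣ)
    (ω : v.adicCompletion ↥(maximalRealSubfield L) → ℂ)
    (hω0 : ∀ t ∈ v.adicCompletionIntegers ↥(maximalRealSubfield L), ω t = 1)
    (hωout : ∀ t : v.adicCompletion ↥(maximalRealSubfield L), t ∉ v.adicCompletionIntegers ↥(maximalRealSubfield L) →
      ω t = (letI := Extension.fintype (𝓞 ↥(maximalRealSubfield L)) ↥(maximalRealSubfield L) L (𝓞 L) v; ∏ w : v.Extension (𝓞 L), ((χ w (a w t) : ℂˣ) : ℂ)))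
    (t : v.adicCompletion ↥(maximalRealSubfield L)) : ‖ω t‖ ≤ 1 := by
  by_cases h : t ∈ v.adicCompletionIntegers ↥(maximalRealSubfield L)
  · rw [hω0 t h, norm_one]
  · rw [hωout t h]
    exact K2E1ChiLocalWeightShellU2.norm_prod_chi_le_one L v χ hχb (fun w => a w t)

end Summit.HodgeConjecture.HodgeConjecture.Cruxes.H413.K2E1ChiLocalWeightContinuousU2

end
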